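import Summits.CriticalPhenomena.PercolationContinuityZ3.Theorems.Transplant.AutChartOrbitsCriticalContinuity
import HarnessLib

/-!
# `θ(p_c) = 0` on a ℤ²-PERIODIC graph that is NOT VERTEX-TRANSITIVE: the bilayer 'square lattice over square-lattice-with-NE-diagonals', through
# the orbit theorem «AutChartOrbitsCriticalContinuity» with TWO orbits of the translation group (customer (c4) of P3-NILPOTENT §20.2)

builds on p205010 (kernel theorem, internal audit signed; external expert review pending): the unconditional theorem of this file is an instance of
`AutChart.criticalContinuity_of_autSubgroup_finite_orbits` («AutChartOrbitsCriticalContinuity» §5, p493117), which runs through the aligned multi-type scaled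
node «SkelFrmScaledAlignedHoldsAll» (p490798) and so builds on p205010.  Lane `prim-bschramm`, seat `prim-hp-8` gen 58 (port pen; row (c4) handed over by
the design owner p3 gen 28, bus 2026-08-27 #5861).  Helper file (`--supports stmt-CriticalPhenomena-4575 --as helper`); no node, no statement, no
`@[conjecture]` is declared or edited; nothing about the end-state node or Conj. 4 in general is claimed.

THE GRAPH `Y` (vertices `ℤ² × Fin 2`).  Sheet `0` = the square lattice `(v,0) ∼ (v ± eᵢ, 0)`; sheet `1` = the square lattice WITH the north-east diagonals
`(v,1) ∼ (v ± eᵢ, 1)`, `(v,1) ∼ (v ± (e₀ + e₁), 1)`; vertical rungs `(v,0) ∼ (v,1)`.  Degrees `5` on sheet `0` and `7` on sheet `1` (`degree_sheet0/1`), so EVERY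
automorphism preserves the sheets (`sheet_apply_eq`) and **`Y` is not vertex-transitive** (`not_vertexTransitive`): no one-type / transitive node of the tree
applies, and `Aut(Y)` has exactly the two orbits of the translation subgroup — the lane's first periodic, non-vertex-transitive customer (P3-NILPOTENT §20.2 (c4)).
THE PROOF (as for (c3) «CayleyZ2DihSkewBilayer»).  `A :=` the translations `(w, j) ↦ (w + u, j)` (`transl = shiftHom.range ≤ Aut(Y)`), two orbits, transversal
`reps = {(0,0), (0,1)}`; chart `φ(v, j) := v`, translated by `A`, constant on `reps`; `N := 1` (every bond moves the position by a vector of sup-norm `≤ 1`, the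
diagonal included); exact steps `± eᵢ` along single in-sheet bonds at every vertex; `Y` connected and locally finite.  Hence
**`Z2BilayerNE.criticalContinuity : ∀ v, θ_v(p_c(Y)) = 0` — unconditional** (no cylinder, growth, degree-bound or uniqueness verification in this file).
[cite: BenjaminiSchramm1996, Conj. 4; §2 (almost transitive graphs)] [cite: KozmaNitzan2024, §4 p. 16 (Lemma 8: the lattice symmetries)] [this work]
-/

noncomputable section

namespace Summit.CriticalPhenomena.PercolationContinuityZ3.Theorems.Transplant

open MeasureTheory Literature.Probability.Percolation Literature.Probability.LatticeModels SimpleGraph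
open scoped Classical

namespace Z2BilayerNE

/-! ## §1 The bilayer `Y`: square lattice over square lattice with NE diagonals, vertical rungs -/

/-- The vertices: position and sheet. [folklore] -/
abbrev Vtx : Type := Site 2 × Fin 2

/-- The unit vectors `e₀, e₁` of `ℤ²`. [folklore] -/
def e (i : Fin 2) : Site 2 := Pi.single i 1

/-- The north-east diagonal `e₀ + e₁`. [folklore] -/
def dg : Site 2 := e 0 + e 1

/-- `eᵢ ≠ 0`. [folklore] -/
theorem e_ne_zero (i : Fin 2) : e i ≠ 0 := fun h => by simpa [e] using congrFun h i

/-- `e₀ + e₁ ≠ 0`. [folklore] -/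
theorem dg_ne_zero : dg ≠ 0 := fun h => by simpa [dg, e] using congrFun h 0

/-- The coordinates of `eᵢ` are `0` or `1`. [folklore] -/
theorem abs_e_le (k i : Fin 2) : |e k i| ≤ 1 := by
  fin_cases k <;> fin_cases i <;> simp [e]

/-- The coordinates of the diagonal are `1`. [folklore] -/
theorem abs_dg_le (i : Fin 2) : |dg i| ≤ 1 := by
  fin_cases i <;> simp [dg, e]

/-- **The bilayer `Y`**: generating relation = an axis step inside a sheet, a NE diagonal inside sheet `1`, or a vertical rung `(v,0) ↦ (v,1)`.
[cite: BenjaminiSchramm1996, §2 (almost transitive graphs)] -/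
def graph : SimpleGraph Vtx :=
  SimpleGraph.fromRel fun a b =>
    (b.2 = a.2 ∧ (b.1 = a.1 + e 0 ∨ b.1 = a.1 + e 1)) ∨ (a.2 = 1 ∧ b.2 = 1 ∧ b.1 = a.1 + dg) ∨ (a.2 = 0 ∧ b.2 = 1 ∧ b.1 = a.1)

/-- Adjacency unfolded. [folklore] -/
theorem adj_iff (a b : Vtx) : graph.Adj a b ↔ a ≠ b ∧
    (((b.2 = a.2 ∧ (b.1 = a.1 + e 0 ∨ b.1 = a.1 + e 1)) ∨ (a.2 = 1 ∧ b.2 = 1 ∧ b.1 = a.1 + dg) ∨ (a.2 = 0 ∧ b.2 = 1 ∧ b.1 = a.1)) ∨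
      ((a.2 = b.2 ∧ (a.1 = b.1 + e 0 ∨ a.1 = b.1 + e 1)) ∨ (b.2 = 1 ∧ a.2 = 1 ∧ a.1 = b.1 + dg) ∨ (b.2 = 0 ∧ a.2 = 1 ∧ a.1 = b.1))) :=
  SimpleGraph.fromRel_adj _ _ _

/-- A vertex differs from its translate by a nonzero vector. [folklore] -/
theorem ne_add_of_ne_zero (v : Site 2) (j : Fin 2) {u : Site 2} (hu : u ≠ 0) : ((v, j) : Vtx) ≠ (v + u, j) := fun h =>
  hu (by simpa using (congrArg Prod.fst h).symm)

/-- An axis step inside a sheet is a bond. [folklore] -/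
theorem adj_axis (v : Site 2) (j : Fin 2) (i : Fin 2) : graph.Adj (v, j) (v + e i, j) := by
  refine (adj_iff _ _).2 ⟨ne_add_of_ne_zero v j (e_ne_zero i), Or.inl (Or.inl ⟨rfl, ?_⟩)⟩
  fin_cases i
  · exact Or.inl rfl
  · exact Or.inr rfl

/-- An axis step backwards inside a sheet is a bond. [folklore] -/
theorem adj_axis' (v : Site 2) (j : Fin 2) (i : Fin 2) : graph.Adj (v, j) (v - e i, j) := by
  have := (adj_axis (v - e i) j i).symm
  rwa [sub_add_cancel] at this

/-- A NE diagonal inside sheet `1` is a bond. [folklore] -/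
theorem adj_diag (v : Site 2) : graph.Adj (v, 1) (v + dg, 1) :=
  (adj_iff _ _).2 ⟨ne_add_of_ne_zero v 1 dg_ne_zero, Or.inl (Or.inr (Or.inl ⟨rfl, rfl, rfl⟩))⟩

/-- A SW diagonal inside sheet `1` is a bond. [folklore] -/
theorem adj_diag' (v : Site 2) : graph.Adj (v, 1) (v - dg, 1) := by
  have := (adj_diag (v - dg)).symm
  rwa [sub_add_cancel] at this

/-- A vertical rung upwards is a bond. [folklore] -/
theorem adj_rung (v : Site 2) : graph.Adj (v, 0) (v, 1) :=
  (adj_iff _ _).2 ⟨fun h => by simpa using congrArg Prod.snd h, Or.inl (Or.inr (Or.inr ⟨rfl, rfl, rfl⟩))⟩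

/-- A vertical rung downwards is a bond. [folklore] -/
theorem adj_rung' (v : Site 2) : graph.Adj (v, 1) (v, 0) := (adj_rung v).symm
/-- The five neighbours of a sheet-`0` vertex `(v, 0)`. [folklore] -/
def nbrs0 (v : Site 2) : Finset Vtx := {(v + e 0, 0), (v + e 1, 0), (v - e 0, 0), (v - e 1, 0), (v, 1)}

/-- The seven neighbours of a sheet-`1` vertex `(v, 1)`. [folklore] -/
def nbrs1 (v : Site 2) : Finset Vtx := {(v + e 0, 1), (v + e 1, 1), (v - e 0, 1), (v - e 1, 1), (v + dg, 1), (v - dg, 1), (v, 0)}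

/-- The neighbours of a vertex, by sheet. [folklore] -/
def nbrs (a : Vtx) : Finset Vtx := if a.2 = 0 then nbrs0 a.1 else nbrs1 a.1

/-- `nbrs (v, 0) = nbrs0 v`. [folklore] -/
@[simp] theorem nbrs_zero (v : Site 2) : nbrs (v, 0) = nbrs0 v := by simp [nbrs]

/-- `nbrs (v, 1) = nbrs1 v`. [folklore] -/
@[simp] theorem nbrs_one (v : Site 2) : nbrs (v, 1) = nbrs1 v := by simp [nbrs]

/-- Every neighbour is one of the candidates. [folklore] -/
theorem mem_nbrs_of_adj {a b : Vtx} (h : graph.Adj a b) : b ∈ nbrs a := by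
  obtain ⟨v, j⟩ := a
  obtain ⟨w, k⟩ := b
  obtain ⟨-, h | h⟩ := (adj_iff _ _).1 h
  · rcases h with ⟨hk, hw⟩ | ⟨hj, hk, hw⟩ | ⟨hj, hk, hw⟩
    · simp only at hk hw
      subst hk
      rcases fin_two_eq_zero_or_one k with rfl | rfl <;> rcases hw with rfl | rfl <;> simp [nbrs0, nbrs1]
    · simp only at hj hk hw
      subst hj hk hw
      simp [nbrs1]
    · simp only at hj hk hw
      subst hj hk hw
      simp [nbrs0]
  · rcases h with ⟨hk, hw⟩ | ⟨hk, hj, hw⟩ | ⟨hk, hj, hw⟩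
    · simp only at hk hw
      subst hk
      rcases hw with hw | hw
      · have : w = v - e 0 := by rw [hw, add_sub_cancel_right]
        subst this; rcases fin_two_eq_zero_or_one j with rfl | rfl <;> simp [nbrs0, nbrs1]
      · have : w = v - e 1 := by rw [hw, add_sub_cancel_right]
        subst this; rcases fin_two_eq_zero_or_one j with rfl | rfl <;> simp [nbrs0, nbrs1]
    · simp only at hk hj hw
      subst hk hj
      have : w = v - dg := by rw [hw, add_sub_cancel_right]
      subst this; simp [nbrs1]
    · simp only at hk hj hw
      subst hk hj hw
      simp [nbrs1]

/-- Conversely every candidate is a neighbour. [folklore] -/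
theorem adj_of_mem_nbrs {a b : Vtx} (h : b ∈ nbrs a) : graph.Adj a b := by
  obtain ⟨v, j⟩ := a
  rcases fin_two_eq_zero_or_one j with rfl | rfl
  · simp only [nbrs_zero, nbrs0, Finset.mem_insert, Finset.mem_singleton] at h
    rcases h with rfl | rfl | rfl | rfl | rfl
    exacts [adj_axis v 0 0, adj_axis v 0 1, adj_axis' v 0 0, adj_axis' v 0 1, adj_rung v]
  · simp only [nbrs_one, nbrs1, Finset.mem_insert, Finset.mem_singleton] at h
    rcases h with rfl | rfl | rfl | rfl | rfl | rfl | rfl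
    exacts [adj_axis v 1 0, adj_axis v 1 1, adj_axis' v 1 0, adj_axis' v 1 1, adj_diag v, adj_diag' v, adj_rung' v]

/-- The neighbour set lies in the candidate set. [folklore] -/
theorem neighborSet_subset (a : Vtx) : graph.neighborSet a ⊆ ↑(nbrs a) := fun _ hb => mem_nbrs_of_adj hb

/-- `Y` is locally finite. [folklore] -/
instance graph_locallyFinite : graph.LocallyFinite := fun a => ((Finset.finite_toSet _).subset (neighborSet_subset a)).fintype

/-- The neighbours of a vertex are exactly the candidates. [folklore] -/
theorem neighborFinset_eq (a : Vtx) : graph.neighborFinset a = nbrs a :=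
  Finset.ext fun _ => ⟨fun hb => mem_nbrs_of_adj ((mem_neighborFinset _ _ _).1 hb), fun hb => (mem_neighborFinset _ _ _).2 (adj_of_mem_nbrs hb)⟩

/-- Along a bond the position changes by a vector of sup-norm `≤ 1` (axis step, diagonal, or rung). [folklore] -/
theorem abs_sub_le {a b : Vtx} (h : graph.Adj a b) (i : Fin 2) : |b.1 i - a.1 i| ≤ 1 := by
  have hb := mem_nbrs_of_adj h
  obtain ⟨v, j⟩ := a
  rcases fin_two_eq_zero_or_one j with rfl | rfl
  · simp only [nbrs_zero, nbrs0, Finset.mem_insert, Finset.mem_singleton] at hb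
    rcases hb with rfl | rfl | rfl | rfl | rfl <;>
      simp only [Pi.add_apply, Pi.sub_apply, add_sub_cancel_left, sub_sub_cancel_left, abs_neg, sub_self, abs_zero, zero_le_one]
    exacts [abs_e_le 0 i, abs_e_le 1 i, abs_e_le 0 i, abs_e_le 1 i]
  · simp only [nbrs_one, nbrs1, Finset.mem_insert, Finset.mem_singleton] at hb
    rcases hb with rfl | rfl | rfl | rfl | rfl | rfl | rfl <;>
      simp only [Pi.add_apply, Pi.sub_apply, add_sub_cancel_left, sub_sub_cancel_left, abs_neg, sub_self, abs_zero, zero_le_one]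
    exacts [abs_e_le 0 i, abs_e_le 1 i, abs_e_le 0 i, abs_e_le 1 i, abs_dg_le i, abs_dg_le i]

/-! ## §2 `Y` is connected -/

/-- Walking `n` axis steps inside a sheet. [folklore] -/
theorem reachable_add_nsmul (v : Site 2) (j : Fin 2) (i : Fin 2) (n : ℕ) : graph.Reachable (v, j) (v + n • e i, j) := by
  induction n with
  | zero => simp
  | succ n ih =>
    refine ih.trans (Adj.reachable ?_)
    have := adj_axis (v + n • e i) j i
    rwa [add_assoc, ← succ_nsmul] at this

/-- Walking `n` axis steps backwards inside a sheet. [folklore] -/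
theorem reachable_sub_nsmul (v : Site 2) (j : Fin 2) (i : Fin 2) (n : ℕ) : graph.Reachable (v, j) (v - n • e i, j) := by
  induction n with
  | zero => simp
  | succ n ih =>
    refine ih.trans (Adj.reachable ?_)
    have := adj_axis' (v - n • e i) j i
    rwa [sub_sub, ← succ_nsmul] at this

/-- Walking an integer multiple of an axis vector inside a sheet. [folklore] -/
theorem reachable_add_zsmul (v : Site 2) (j : Fin 2) (i : Fin 2) (n : ℤ) : graph.Reachable (v, j) (v + n • e i, j) := by
  cases n with
  | ofNat n => rw [Int.ofNat_eq_natCast, natCast_zsmul]; exact reachable_add_nsmul v j i n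
  | negSucc n => rw [negSucc_zsmul, ← sub_eq_add_neg]; exact reachable_sub_nsmul v j i (n + 1)

/-- `v = v₀ e₀ + v₁ e₁`. [folklore] -/
theorem eq_sum_e (v : Site 2) : v = v 0 • e 0 + v 1 • e 1 := by
  funext i
  fin_cases i <;> simp [e]

/-- Every vertex of a sheet is joined to the origin of that sheet. [folklore] -/
theorem reachable_origin (v : Site 2) (j : Fin 2) : graph.Reachable ((0 : Site 2), j) (v, j) := by
  have h := (reachable_add_zsmul 0 j 0 (v 0)).trans (reachable_add_zsmul (0 + v 0 • e 0) j 1 (v 1))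
  rwa [zero_add, ← eq_sum_e v] at h

/-- **`Y` is connected**: walk the position inside a sheet; the sheets are joined by a rung. [folklore] -/
theorem connected : graph.Connected := by
  haveI : Nonempty Vtx := ⟨((0 : Site 2), 0)⟩
  refine Connected.mk fun a b => ?_
  suffices H : ∀ w : Vtx, graph.Reachable ((0 : Site 2), 0) w from (H a).symm.trans (H b)
  rintro ⟨v, j⟩
  rcases fin_two_eq_zero_or_one j with rfl | rfl
  · exact reachable_origin v 0
  · exact (adj_rung 0).reachable.trans (reachable_origin v 1)

/-! ## §3 Frames: the translations by `ℤ²`, a subgroup of `Aut(Y)` with two orbits -/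

/-- Translating the position preserves adjacency. [folklore] -/
theorem adj_shift {a b : Vtx} (u : Site 2) (h : graph.Adj a b) : graph.Adj (a.1 + u, a.2) (b.1 + u, b.2) := by
  have hb := mem_nbrs_of_adj h
  obtain ⟨v, j⟩ := a
  rcases fin_two_eq_zero_or_one j with rfl | rfl
  · simp only [nbrs_zero, nbrs0, Finset.mem_insert, Finset.mem_singleton] at hb
    rcases hb with rfl | rfl | rfl | rfl | rfl <;> simp only
    · rw [add_right_comm]; exact adj_axis _ _ 0
    · rw [add_right_comm]; exact adj_axis _ _ 1
    · rw [sub_add_eq_add_sub]; exact adj_axis' _ _ 0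
    exacts [by rw [sub_add_eq_add_sub]; exact adj_axis' _ _ 1, adj_rung _]
  · simp only [nbrs_one, nbrs1, Finset.mem_insert, Finset.mem_singleton] at hb
    rcases hb with rfl | rfl | rfl | rfl | rfl | rfl | rfl <;> simp only
    · rw [add_right_comm]; exact adj_axis _ _ 0
    · rw [add_right_comm]; exact adj_axis _ _ 1
    · rw [sub_add_eq_add_sub]; exact adj_axis' _ _ 0
    · rw [sub_add_eq_add_sub]; exact adj_axis' _ _ 1
    exacts [by rw [add_right_comm]; exact adj_diag _, by rw [sub_add_eq_add_sub]; exact adj_diag' _, adj_rung' _]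

/-- **Translation of the position** `(w, j) ↦ (w + u, j)`: the FRAMES. [cite: BenjaminiSchramm1996, §2] -/
def shiftIso (u : Site 2) : graph ≃g graph where
  toEquiv := Equiv.prodCongr (Equiv.addRight u) (Equiv.refl _)
  map_rel_iff' := by
    intro a b
    show graph.Adj (a.1 + u, a.2) (b.1 + u, b.2) ↔ graph.Adj a b
    refine ⟨fun h => ?_, adj_shift u⟩
    have := adj_shift (-u) h
    simpa using this

/-- `shiftIso u (w, j) = (w + u, j)`. [folklore] -/
@[simp] theorem shiftIso_apply (u : Site 2) (a : Vtx) : shiftIso u a = (a.1 + u, a.2) := rfl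

/-- The translations as a homomorphism `ℤ² → Aut(Y)`. [folklore] -/
def shiftHom : Multiplicative (Site 2) →* (graph ≃g graph) where
  toFun u := shiftIso (Multiplicative.toAdd u)
  map_one' := RelIso.ext fun a => by simp
  map_mul' u u' := RelIso.ext fun a => by
    simp only [shiftIso_apply, toAdd_mul, RelIso.mul_apply]
    rw [add_right_comm, add_assoc]

/-- `shiftHom u (w, j) = (w + u, j)`. [folklore] -/
@[simp] theorem shiftHom_apply (u : Multiplicative (Site 2)) (a : Vtx) : shiftHom u a = (a.1 + Multiplicative.toAdd u, a.2) := rfl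

/-- **The frames**: the subgroup `A ≤ Aut(Y)` of translations of the position. [cite: BenjaminiSchramm1996, §2] -/
def transl : Subgroup (graph ≃g graph) := shiftHom.range

/-- Membership in `A`: `α = shiftIso u` for some `u`. [folklore] -/
theorem mem_transl {α : graph ≃g graph} : α ∈ transl ↔ ∃ u : Site 2, shiftIso u = α := by
  rw [transl, MonoidHom.mem_range]
  exact ⟨fun ⟨u, hu⟩ => ⟨Multiplicative.toAdd u, hu⟩, fun ⟨u, hu⟩ => ⟨Multiplicative.ofAdd u, hu⟩⟩

/-- The transversal: the origins of the two sheets. [folklore] -/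
def reps : Finset Vtx := {((0 : Site 2), 0), ((0 : Site 2), 1)}

/-- A representative has position `0`. [folklore] -/
theorem fst_eq_zero_of_mem_reps {r : Vtx} (hr : r ∈ reps) : r.1 = 0 := by
  simp only [reps, Finset.mem_insert, Finset.mem_singleton] at hr
  rcases hr with rfl | rfl <;> rfl

/-- **`reps` meets every `A`-orbit at most once.** [folklore] -/
theorem reps_trans : ∀ r ∈ reps, ∀ r' ∈ reps, ∀ α ∈ transl, α r = r' → r = r' := by
  intro r hr r' hr' α hα h
  obtain ⟨u, rfl⟩ := mem_transl.1 hα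
  rw [shiftIso_apply] at h
  have h2 := congrArg Prod.snd h
  dsimp only at h2
  exact Prod.ext (by rw [fst_eq_zero_of_mem_reps hr, fst_eq_zero_of_mem_reps hr']) h2

/-- **`reps` meets every `A`-orbit**: `(v, j) = shiftIso v (0, j)`. [folklore] -/
theorem reps_cover : ∀ w : Vtx, ∃ α ∈ transl, ∃ r ∈ reps, α r = w := by
  rintro ⟨v, j⟩
  exact ⟨shiftIso v, mem_transl.2 ⟨v, rfl⟩, ((0 : Site 2), j), by fin_cases j <;> simp [reps], by simp⟩

/-! ## §4 Degrees `5` and `7`: the sheets are invariant under every automorphism; `Y` is not vertex-transitive -/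

/-- Translations preserve degrees. [folklore] -/
theorem degree_shift (u : Site 2) (a : Vtx) : graph.degree (a.1 + u, a.2) = graph.degree a := by
  rw [← shiftIso_apply u a, Iso.degree_eq]

/-- The origin of sheet `0` has degree `5`. [folklore] -/
theorem degree_origin0 : graph.degree (((0 : Site 2), 0) : Vtx) = 5 := by
  rw [← card_neighborFinset_eq_degree, neighborFinset_eq]
  decide

/-- The origin of sheet `1` has degree `7`. [folklore] -/
theorem degree_origin1 : graph.degree (((0 : Site 2), 1) : Vtx) = 7 := by
  rw [← card_neighborFinset_eq_degree, neighborFinset_eq]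
  decide

/-- **Every vertex of sheet `0` has degree `5`.** [folklore] -/
theorem degree_sheet0 (v : Site 2) : graph.degree ((v, 0) : Vtx) = 5 := by
  have h := degree_shift v (((0 : Site 2), 0) : Vtx)
  rw [zero_add] at h
  rw [h, degree_origin0]

/-- **Every vertex of sheet `1` has degree `7`.** [folklore] -/
theorem degree_sheet1 (v : Site 2) : graph.degree ((v, 1) : Vtx) = 7 := by
  have h := degree_shift v (((0 : Site 2), 1) : Vtx)
  rw [zero_add] at h
  rw [h, degree_origin1]

/-- The degree of `(v, j)` determines the sheet: `5` on sheet `0`, `7` on sheet `1`. [folklore] -/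
theorem degree_eq (a : Vtx) : graph.degree a = if a.2 = 0 then 5 else 7 := by
  obtain ⟨v, j⟩ := a
  rcases fin_two_eq_zero_or_one j with rfl | rfl
  · simpa using degree_sheet0 v
  · simpa using degree_sheet1 v

/-- **EVERY automorphism of `Y` preserves the sheets** (degrees are preserved). [this work] -/
theorem sheet_apply_eq (α : graph ≃g graph) (a : Vtx) : (α a).2 = a.2 := by
  have hdeg : graph.degree (α a) = graph.degree a := Iso.degree_eq α a
  rw [degree_eq, degree_eq] at hdeg
  rcases fin_two_eq_zero_or_one (α a).2 with h1 | h1 <;> rcases fin_two_eq_zero_or_one a.2 with h2 | h2 <;> simp only [h1, h2] at hdeg ⊢ <;> simp at hdeg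

/-- **`Y` IS NOT VERTEX-TRANSITIVE**: no automorphism carries a sheet-`0` vertex to a sheet-`1` vertex. [this work] -/
theorem not_vertexTransitive : ¬ ∃ α : graph ≃g graph, α (((0 : Site 2), 0) : Vtx) = (((0 : Site 2), 1) : Vtx) := by
  rintro ⟨α, hα⟩
  have h := sheet_apply_eq α (((0 : Site 2), 0) : Vtx)
  rw [hα] at h
  exact absurd h (by decide)

/-! ## §5 The chart `(v, j) ↦ v` and the unconditional theorem -/

/-- The chart is translated by `A`: `φ (α w) = φ w + (φ (α t) − φ t)` with `t = (0, 0)`. [folklore] -/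
theorem chart_transl : ∀ α ∈ transl, ∀ w : Vtx, (α w).1 = w.1 + ((α (((0 : Site 2), (0 : Fin 2)) : Vtx)).1 - (((0 : Site 2), (0 : Fin 2)) : Vtx).1) := by
  intro α hα w
  obtain ⟨u, rfl⟩ := mem_transl.1 hα
  simp

/-- The chart is constant on the transversal. [folklore] -/
theorem chart_reps : ∀ r ∈ reps, ∀ r' ∈ reps, r.1 = r'.1 := fun r hr r' hr' => by
  rw [fst_eq_zero_of_mem_reps hr, fst_eq_zero_of_mem_reps hr']

/-- `1`-range along the bonds at the representatives (indeed along every bond). [folklore] -/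
theorem chart_lip : ∀ r ∈ reps, ∀ w : Vtx, graph.Adj r w → ∀ i : Fin 2, |w.1 i - r.1 i| ≤ ((1 : ℕ) : ℤ) :=
  fun _ _ _ h i => by exact_mod_cast abs_sub_le h i

/-- **Exact unit steps along single bonds at the representatives** (indeed at every vertex): the in-sheet axis steps. [this work] -/
theorem chart_step (a : Vtx) (i : Fin 2) (σ : ℤˣ) : ∃ w : Vtx, graph.Adj a w ∧ w.1 = a.1 + Pi.single i (((1 : ℕ) : ℤ) * σ) := by
  refine ⟨(a.1 + Pi.single i (σ : ℤ), a.2), ?_, by simp⟩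
  rcases Int.units_eq_one_or σ with rfl | rfl
  · simpa [e] using adj_axis a.1 a.2 i
  · have h := adj_axis' a.1 a.2 i
    have he : a.1 - e i = a.1 + Pi.single i (((-1 : ℤˣ) : ℤ)) := by
      rw [Units.val_neg, Units.val_one, sub_eq_add_neg, e, Pi.single_neg]
    rwa [he] at h

/-- **THEOREM (unconditional).  `θ_v(p_c) = 0` at every vertex of the non-vertex-transitive bilayer `Y`** (square lattice over square lattice with NE
diagonals, vertical rungs), by the orbit theorem with TWO orbits (the sheets) of the translation subgroup `ℤ² ≤ Aut(Y)`, chart = position, `N = 1`.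
builds on p205010 (kernel theorem, internal audit signed; external expert review pending).
[cite: BenjaminiSchramm1996, Conj. 4; §2 (almost transitive graphs)] [cite: KozmaNitzan2024, §4 p. 16 (Lemma 8)] -/
theorem criticalContinuity (v : Vtx) : theta graph v (criticalProbIOf graph v) = 0 :=
  AutChart.criticalContinuity_of_autSubgroup_finite_orbits connected transl reps reps_trans reps_cover Prod.fst
    (t := (((0 : Site 2), (0 : Fin 2)) : Vtx)) chart_transl chart_reps 1 le_rfl chart_lip (fun r _ i σ => chart_step r i σ) v

/-- **… and the same-`p` drop at every vertex**: every `p` with `θ_v(p) > 0` admits `q < p` with `θ_v(q) > 0`. [cite: BenjaminiSchramm1996, Conj. 4] -/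
theorem drop (v : Vtx) (p : unitInterval) (hθ : 0 < theta graph v p) : ∃ q : unitInterval, (q : ℝ) < p ∧ 0 < theta graph v q :=
  drop_at_of_critical graph v (P := fun _ => True) (fun _ => criticalContinuity v) p trivial hθ

/-- **Conj. 4 in its own shape on `Y`: `p_c < 1 ∧ θ_v(p_c) = 0`** (p3 g28's §6 front-end, by name; append 2026-08-27). [cite: BenjaminiSchramm1996, Conj. 4; §2 Conj. 1] -/
theorem conj4 (v : Vtx) : criticalProb graph v < 1 ∧ theta graph v (criticalProbIOf graph v) = 0 := AutChart.conj4_of_autSubgroup_finite_orbits connected transl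
  reps reps_trans reps_cover Prod.fst (t := (((0 : Site 2), (0 : Fin 2)) : Vtx)) chart_transl chart_reps 1 le_rfl chart_lip (fun r _ i σ => chart_step r i σ) v

end Z2BilayerNE

end Summit.CriticalPhenomena.PercolationContinuityZ3.Theorems.Transplant

end
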